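import Summits.HodgeConjecture.CorCM.HypDel.BaseDescentOfDescentToIntersection
import Literature.AlgebraicGeometry.ShimuraVarieties.UnitaryAuxiliaryHeckeQuotientDescentExt
import Literature.AlgebraicGeometry.ShimuraVarieties.UnitaryShimuraCanonicalModelPrintedForm
import Literature.NumberTheory.ComplexMultiplication.CMTypeQuadraticTwist
import Literature.NumberTheory.NumberFields.QuadraticTwistIntersection
import Literature.NumberTheory.NumberFields.QuadraticTwistCMField
import Summits.HodgeConjecture.HodgeConjecture.Theses.HCCMUnconditional
import Literature.AlgebraicGeometry.ShimuraVarieties.UnitaryCanonicalModelDescentToIntersectionHolds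
import HarnessLib

/-!
# hDel by the K-TWIST: `canonicalModel_exists_printed` (= binder `hDel`, crux `HDel`) for EVERY CM field, from the two printed
# citations F1-ext ([Deligne 1979] 2.3.1/2.2.5 for the twisted Hodge-type datum) and I-6 ([Deligne 1971] Prop. 5.10)

Cell `hodgecm-mathlib`, fan A, rung A-I; Summits lane `HodgeConjecture/Theorems/` (`--supports stmt-HodgeConjecture-24835`); seat A-p05 g3.
Crux `HDel` = stmt-HodgeConjecture-24835 (route `HCCMUnconditional`, decl `Summit.HodgeConjecture.HodgeConjecture.Theses.HCCMUnconditional.HDel`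
:= `PrintedCitationHypotheses.HypDel` := `UnitaryCanonicalModel.canonicalModel_exists_printed`).  Cut of record v12 «K-TWIST» (A-p05 g3
proposal 2026-08-28T05:27:30Z; B-typ04 sanity-read PASS 05:28:58Z and verdict YES 05:33:54Z; director g2 ruling 05:35:20Z).  THEOREMS ONLY;
no definition, no named fact; nothing of [Deligne1979]/[Deligne1971] is asserted — the two printed citations enter as hypotheses
(`hF1e : Aux.canonicalModel_exists_ext_printed`, `h510 : descentToIntersection_printed`), exactly as the skeleton's registered fact-level
stubs `stub_F1ext` / `stub_I6`.  HC_CM is proved only modulo the 7 printed citations until rung 0 closes; with this file `hDel` is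
conditional on {F1-ext, I-6} and on NOTHING ELSE, for ALL CM fields `L` (census or not, Galois or not).

## The argument ([Deligne1979ShimuraVarieties] Prop. 2.3.10, type A, read on the unitary datum; two members of the K-family + Prop. 5.10)

For the hDel datum `(L, H, τ, T, hT)` and a complex record system `Sc`, and a prime `q` with `i√q ∉ E₁ := τ(L)(i)` (such a prime exists:
`exists_prime_twistRoot_not_mem`, the number field `E₁` has finitely many subfields), put `E₂ := τ(L)(i√q)`.  Each `Eᵢ = τ(L)(i√pᵢ)` is a
CM number field (`isCMField_fieldRange_sup_adjoin_twistRoot`) containing `τ(L)` and a square root `wᵢ` of `-pᵢ`; the QUADRATIC-TWIST CM type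
`Φᵢ` of `Eᵢ ⊇ L` (`quadraticTwistCMType`: `L`-induced above the place of `τ`, `√-pᵢ ↦ i√pᵢ` elsewhere) is ext-adapted
(`mem_quadraticTwistCMType_of_comp_eq`) with reflex field `E*(Φᵢ) ≤ τ(L) ⊔ ℚ(i√pᵢ) = Eᵢ` (`traceField_quadraticTwistCMType_le`).  F1-ext
([Deligne1979ShimuraVarieties] 2.3.1/2.2.5 for `(U(H) × T₀(Eᵢ), X × {h_{Φᵢ}})`) then gives an `Eᵢ`-form of `∐ Sc.Mc` with the twisted
reciprocity; its finite Hecke quotient is an `Eᵢ`-form of `Sc.Mc` with (62) for `Aut(ℂ/Eᵢ)`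
(`HeckeQuotientExt.exists_isCanonicalDescentOver_of_ext_printed`, [Deligne1971TravauxShimura] (5.11.1)); since `E₁ ∩ E₂ ⊆ τ(L)`
(`subset_range_of_twistRoot_not_mem`), I-6 ([Deligne1971TravauxShimura] Prop. 5.10) descends to `τ(L)`
(`isCanonicalDescentAt_of_descentToIntersection_of_pair`), and `canonicalModel_exists_printed_iff_form` returns the printed shape
(smooth projective `L`-schemes).  Theorems: `isCanonicalDescentAt_of_ext_of_twistFields` (parametric in the two fields),
`isCanonicalDescentAt_of_ext` (the fields supplied), `canonicalModel_exists_printed_of_ext`, `HDel_of_ext`.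

## References
* [Deligne1979ShimuraVarieties] P. Deligne, *Variétés de Shimura*, PSPM 33.2 (1979): 2.2.5, Criterion 2.3.1, 2.3.9–Prop. 2.3.10, Cor. 2.7.21
  (Milne's translation pp. 29, 32–33, 52).
* [Deligne1971TravauxShimura] P. Deligne, *Travaux de Shimura*, Sém. Bourbaki 389 (1971): Prop. 5.10 (p. 157), (5.11.1).
* [Shimura1998] G. Shimura, *Abelian Varieties with Complex Multiplication* (1998), §8.3 Prop. 28, §18.2 Lemma (i).
* [Milne2005ShimuraVarieties] J. S. Milne, *Introduction to Shimura varieties* (2005), Def. 12.8 (62), §14.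
-/

set_option autoImplicit false

noncomputable section

open Function MulAction NumberField IsDedekindDomain CategoryTheory CategoryTheory.Limits Matrix
open scoped Matrix ComplexOrder
open Literature.AlgebraicGeometry Literature.AlgebraicGeometry.Motives
open Literature.NumberTheory.Automorphic Literature.NumberTheory.Automorphic.UnitaryGroup
open Literature.NumberTheory.Automorphic.Liu2021.AppendixC (C5.OpenCompactSubgroup C5.SmallLevel)
open Literature.Geometry.ComplexHyperbolic Literature.Geometry.ComplexHyperbolic.BallModel
open Literature.NumberTheory.Automorphic.ShimuraDissection
open Literature.AlgebraicGeometry.ShimuraVarieties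
open Literature.AlgebraicGeometry.ShimuraVarieties.UnitaryCanonicalModel
open Literature.NumberTheory.ComplexMultiplication (traceField quadraticTwistCMType mem_quadraticTwistCMType_of_comp_eq
  traceField_quadraticTwistCMType_le)
open Literature.NumberTheory.NumberFields (twistRoot twistRoot_mul_self subset_range_of_twistRoot_not_mem
  exists_prime_twistRoot_not_mem isCMField_fieldRange_sup_adjoin_twistRoot finiteDimensional_fieldRange_sup_adjoin_twistRoot
  apply_mem_fieldRange_sup_adjoin_twistRoot twistRoot_mem_fieldRange_sup_adjoin_twistRoot twistRoot_mul_self_subtype)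

namespace Summit.HodgeConjecture.CorCM.HypDel

/-! ### §1. The closing step, parametric in the two twist fields -/

/-- **K-TWIST closing step, parametric in the two twist fields.**  For an hDel datum `(L, H, τ, T, hT)` and a complex record system
`Sc`, let `E₁, E₂ ⊆ ℂ` be CM number fields containing `τ(L)` and square roots `w₁`, `w₂` of `-p`, `-q` (`p, q > 0`), meeting inside
`τ(L)`.  THEN F1-ext ([Deligne1979ShimuraVarieties] 2.3.1/2.2.5 for the twisted auxiliary datum `(U(H) × T₀(Eᵢ), X × {h_{Φᵢ}})`, `Φᵢ` the
quadratic-twist CM type — over `Eᵢ ⊇ τ(L)·E*(Φᵢ)` by `traceField_quadraticTwistCMType_le`) and I-6 ([Deligne1971TravauxShimura] Prop. 5.10)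
give an `L`-form of `Sc.Mc` along `τ` with Shimura reciprocity (62): the Hecke-quotient glue
`HeckeQuotientExt.exists_isCanonicalDescentOver_of_ext_printed` over each `Eᵢ`, then `isCanonicalDescentAt_of_descentToIntersection_of_pair`.
[cite: Deligne1979ShimuraVarieties, 2.3.1, 2.2.5, 2.3.9–2.3.10] [cite: Deligne1971TravauxShimura, Prop. 5.10 p. 157 and (5.11.1)]
[cite: Shimura1998, §8.3 Prop. 28] -/
theorem isCanonicalDescentAt_of_ext_of_twistFields (hF1e : Aux.canonicalModel_exists_ext_printed)
    (h510 : descentToIntersection_printed)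
    {L : Type} [Field L] [NumberField L] [IsCMField L] (H : Matrix (Fin 3) (Fin 3) L) (τ : L →+* ℂ)
    (T : GL (Fin 3) ℂ) (hT : formCongr (starRingEnd ℂ) T (H.map τ) = BallModel.J)
    (hpos : ∀ τ' : L →+* ℂ, InfinitePlace.mk τ' ≠ InfinitePlace.mk τ → (H.map τ').PosDef)
    (hanis : ∀ v : Fin 3 → L, UnitaryGroup.hermForm (cmConjRingHom L) H v v = 0 → v = 0)
    (K₀ : C5.OpenCompactSubgroup ↥(finAdelic (↥(maximalRealSubfield L)) L (IsCMField.complexConj L) 3 H))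
    (htf : ∀ g : finAdelic (↥(maximalRealSubfield L)) L (IsCMField.complexConj L) 3 H,
      ∀ γ ∈ arithmeticLevel (↥(maximalRealSubfield L)) L (IsCMField.complexConj L) 3 H
        (K₀.1.map (MulAut.conj g).toMonoidHom), IsOfFinOrder γ → γ = 1)
    (Sc : ComplexRecordSystem L H τ T hT K₀)
    (E₁ E₂ : IntermediateField ℚ ℂ) [FiniteDimensional ℚ ↥E₁] [FiniteDimensional ℚ ↥E₂] [IsCMField ↥E₁] [IsCMField ↥E₂]
    (h₁ : ∀ x : L, τ x ∈ E₁) (h₂ : ∀ x : L, τ x ∈ E₂) {p q : ℕ} (hp : 0 < p) (hq : 0 < q)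
    (w₁ : ↥E₁) (hw₁ : w₁ * w₁ = -(p : ↥E₁)) (w₂ : ↥E₂) (hw₂ : w₂ * w₂ = -(q : ↥E₂))
    (hcap : ((E₁ ⊓ E₂ : IntermediateField ℚ ℂ) : Set ℂ) ⊆ Set.range τ) :
    ∃ (M : C5.SmallLevel K₀ ⥤ SchemeOver L) (e : (M ⋙ Motives.baseChangeHom τ) ≅ Sc.Mc), IsCanonicalDescentAt Sc M e := by
  haveI : NumberField ↥E₁ := NumberField.mk
  haveI : NumberField ↥E₂ := NumberField.mk
  -- the complex square roots and the twist types
  have hr₁ : ((w₁ : ↥E₁) : ℂ) * ((w₁ : ↥E₁) : ℂ) = -(p : ℂ) := by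
    have := congrArg (fun z : ↥E₁ => (z : ℂ)) hw₁
    simpa using this
  have hr₂ : ((w₂ : ↥E₂) : ℂ) * ((w₂ : ↥E₂) : ℂ) = -(q : ℂ) := by
    have := congrArg (fun z : ↥E₂ => (z : ℂ)) hw₂
    simpa using this
  -- reflex bounds `τ(L) ⊔ ℚ(wᵢ) ≤ Eᵢ`
  have hle : ∀ (E : IntermediateField ℚ ℂ) (hE : ∀ x : L, τ x ∈ E) (w : ↥E),
      τ.toRatAlgHom.fieldRange ⊔ IntermediateField.adjoin ℚ {(w : ℂ)} ≤ E := by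
    intro E hE w
    refine sup_le ?_ ?_
    · rintro _ ⟨x, rfl⟩
      exact hE x
    · exact IntermediateField.adjoin_simple_le_iff.2 w.2
  -- the two `Eᵢ`-forms with (62), from F1-ext through the Hecke quotient
  have hM₁ := HeckeQuotientExt.exists_isCanonicalDescentOver_of_ext_printed hF1e H τ T hT hpos hanis K₀ htf Sc ↥E₁
    (Aux.toFieldOfMem τ E₁ h₁) (quadraticTwistCMType (Aux.toFieldOfMem τ E₁ h₁) τ hp hw₁ hr₁)
    (fun ρ hρ => mem_quadraticTwistCMType_of_comp_eq (Aux.toFieldOfMem τ E₁ h₁) τ hp hw₁ hr₁ hρ) E₁ h₁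
    ((traceField_quadraticTwistCMType_le (Aux.toFieldOfMem τ E₁ h₁) τ hp hw₁ hr₁).trans (hle E₁ h₁ w₁))
  have hM₂ := HeckeQuotientExt.exists_isCanonicalDescentOver_of_ext_printed hF1e H τ T hT hpos hanis K₀ htf Sc ↥E₂
    (Aux.toFieldOfMem τ E₂ h₂) (quadraticTwistCMType (Aux.toFieldOfMem τ E₂ h₂) τ hq hw₂ hr₂)
    (fun ρ hρ => mem_quadraticTwistCMType_of_comp_eq (Aux.toFieldOfMem τ E₂ h₂) τ hq hw₂ hr₂ hρ) E₂ h₂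
    ((traceField_quadraticTwistCMType_le (Aux.toFieldOfMem τ E₂ h₂) τ hq hw₂ hr₂).trans (hle E₂ h₂ w₂))
  exact isCanonicalDescentAt_of_descentToIntersection_of_pair h510 hpos hanis htf Sc E₁ E₂ h₁ h₂ hM₁ hM₂ hcap

/-! ### §2. The fields supplied: `E₁ = τ(L)(i)`, `E₂ = τ(L)(i√q)` with `i√q ∉ E₁` -/

/-- **K-TWIST closing step, fields supplied**: at every hDel datum and complex record system, F1-ext + I-6 give an `L`-form of `Sc.Mc`
along `τ` with Shimura reciprocity (62) — `isCanonicalDescentAt_of_ext_of_twistFields` at `E₁ := τ(L)(i)`, `E₂ := τ(L)(i√q)` for a prime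
`q` with `i√q ∉ E₁` (`exists_prime_twistRoot_not_mem`), both CM (`isCMField_fieldRange_sup_adjoin_twistRoot`), meeting in `τ(L)`
(`subset_range_of_twistRoot_not_mem`). [cite: Deligne1979ShimuraVarieties, 2.3.1, 2.2.5, 2.3.10] [cite: Deligne1971TravauxShimura, Prop. 5.10 p. 157] -/
theorem isCanonicalDescentAt_of_ext (hF1e : Aux.canonicalModel_exists_ext_printed) (h510 : descentToIntersection_printed)
    {L : Type} [Field L] [NumberField L] [IsCMField L] (H : Matrix (Fin 3) (Fin 3) L) (τ : L →+* ℂ)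
    (T : GL (Fin 3) ℂ) (hT : formCongr (starRingEnd ℂ) T (H.map τ) = BallModel.J)
    (hpos : ∀ τ' : L →+* ℂ, InfinitePlace.mk τ' ≠ InfinitePlace.mk τ → (H.map τ').PosDef)
    (hanis : ∀ v : Fin 3 → L, UnitaryGroup.hermForm (cmConjRingHom L) H v v = 0 → v = 0)
    (K₀ : C5.OpenCompactSubgroup ↥(finAdelic (↥(maximalRealSubfield L)) L (IsCMField.complexConj L) 3 H))
    (htf : ∀ g : finAdelic (↥(maximalRealSubfield L)) L (IsCMField.complexConj L) 3 H,
      ∀ γ ∈ arithmeticLevel (↥(maximalRealSubfield L)) L (IsCMField.complexConj L) 3 H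
        (K₀.1.map (MulAut.conj g).toMonoidHom), IsOfFinOrder γ → γ = 1)
    (Sc : ComplexRecordSystem L H τ T hT K₀) :
    ∃ (M : C5.SmallLevel K₀ ⥤ SchemeOver L) (e : (M ⋙ Motives.baseChangeHom τ) ≅ Sc.Mc), IsCanonicalDescentAt Sc M e := by
  -- `E₁ = τ(L)(i)` and a prime `q` with `i√q ∉ E₁`; `E₂ = τ(L)(i√q)`
  haveI := finiteDimensional_fieldRange_sup_adjoin_twistRoot τ 1
  obtain ⟨q, hq, hqE⟩ := exists_prime_twistRoot_not_mem (τ.toRatAlgHom.fieldRange ⊔ IntermediateField.adjoin ℚ {twistRoot 1})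
  haveI := finiteDimensional_fieldRange_sup_adjoin_twistRoot τ q
  haveI := isCMField_fieldRange_sup_adjoin_twistRoot τ 1 one_ne_zero
  haveI := isCMField_fieldRange_sup_adjoin_twistRoot τ q hq.ne_zero
  refine isCanonicalDescentAt_of_ext_of_twistFields hF1e h510 H τ T hT hpos hanis K₀ htf Sc
    (τ.toRatAlgHom.fieldRange ⊔ IntermediateField.adjoin ℚ {twistRoot 1})
    (τ.toRatAlgHom.fieldRange ⊔ IntermediateField.adjoin ℚ {twistRoot q})
    (apply_mem_fieldRange_sup_adjoin_twistRoot τ 1) (apply_mem_fieldRange_sup_adjoin_twistRoot τ q) Nat.one_pos hq.pos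
    ⟨twistRoot 1, twistRoot_mem_fieldRange_sup_adjoin_twistRoot τ 1⟩ (twistRoot_mul_self_subtype τ 1)
    ⟨twistRoot q, twistRoot_mem_fieldRange_sup_adjoin_twistRoot τ q⟩ (twistRoot_mul_self_subtype τ q) ?_
  -- the census inclusion `E₁ ∩ E₂ ⊆ τ(L)`
  exact subset_range_of_twistRoot_not_mem τ.toRatAlgHom hqE

/-! ### §3. hDel -/

/-- **hDel by the K-TWIST**: `canonicalModel_exists_printed` — the binder `hDel` of the headline, [Deligne1979ShimuraVarieties] 2.2.5 + Cor.
2.7.21 AS PRINTED for `(Res_{L⁺/ℚ} U(H), 𝔹²)`, for EVERY CM field `L` — from the two printed citations F1-ext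
(`Aux.canonicalModel_exists_ext_printed`, [Deligne1979ShimuraVarieties] 2.3.1/2.2.5 for the twisted Hodge-type datum of 2.3.9–2.3.10) and I-6
(`descentToIntersection_printed`, [Deligne1971TravauxShimura] Prop. 5.10): `isCanonicalDescentAt_of_ext` at every datum, returned to the
printed shape by `canonicalModel_exists_printed_iff_form`. [cite: Deligne1979ShimuraVarieties, 2.2.5, 2.3.1, 2.3.10, Cor. 2.7.21]
[cite: Deligne1971TravauxShimura, Prop. 5.10 p. 157] -/
theorem canonicalModel_exists_printed_of_ext (hF1e : Aux.canonicalModel_exists_ext_printed)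
    (h510 : descentToIntersection_printed) : UnitaryCanonicalModel.canonicalModel_exists_printed := by
  refine canonicalModel_exists_printed_iff_form.2 fun L _ _ _ H τ T hT hpos hanis K₀ htf Sc => ?_
  exact isCanonicalDescentAt_of_ext hF1e h510 H τ T hT hpos hanis K₀ htf Sc

/-- **Crux `HDel` modulo the two printed citations** (route `HCCMUnconditional`, item stmt-HodgeConjecture-24835): `HDel` := `HypDel` :=
`canonicalModel_exists_printed`, accepted at that type by unfolding.  The skeleton's head is `HDel_proof := HDel_of_ext stub_F1ext stub_I6`.
[cite: Deligne1979ShimuraVarieties, 2.2.5 and Cor. 2.7.21] [cite: Deligne1971TravauxShimura, Prop. 5.10 p. 157] -/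
theorem HDel_of_ext (hF1e : Aux.canonicalModel_exists_ext_printed) (h510 : descentToIntersection_printed) :
    Summit.HodgeConjecture.HodgeConjecture.Theses.HCCMUnconditional.HDel :=
  canonicalModel_exists_printed_of_ext hF1e h510


/-! ### §4. (v13) I-6 DISCHARGED: hDel ⟸ I-1′ alone -/

/-- **hDel from the ONE printed citation I-1′** ([Deligne1979ShimuraVarieties] 2.3.1/2.2.5 for the twisted Hodge-type datum,
`Aux.canonicalModel_exists_ext_printed`): row I-6 ([Deligne1971TravauxShimura] Prop. 5.10) is now a THEOREM of the tree
(`descentToIntersection_printed_holds`, crew A-p08/A-p03/A-p16/A-p07/A-p02/B-typ01), so `HDel_of_ext` needs `hF1e` only.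
[cite: Deligne1979ShimuraVarieties, 2.2.5, 2.3.1, 2.3.10, Cor. 2.7.21] [cite: Deligne1971TravauxShimura, Prop. 5.10 p. 157] -/
theorem canonicalModel_exists_printed_of_ext' (hF1e : Aux.canonicalModel_exists_ext_printed) :
    UnitaryCanonicalModel.canonicalModel_exists_printed :=
  canonicalModel_exists_printed_of_ext hF1e descentToIntersection_printed_holds

/-- **Crux `HDel` modulo the single printed citation I-1′** (route `HCCMUnconditional`, item stmt-HodgeConjecture-24835; skeleton head
`HDel_proof := HDel_of_ext' stub_F1ext`). [cite: Deligne1979ShimuraVarieties, 2.2.5, 2.3.1 and Cor. 2.7.21]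
[cite: Deligne1971TravauxShimura, Prop. 5.10 p. 157] -/
theorem HDel_of_ext' (hF1e : Aux.canonicalModel_exists_ext_printed) :
    Summit.HodgeConjecture.HodgeConjecture.Theses.HCCMUnconditional.HDel :=
  HDel_of_ext hF1e descentToIntersection_printed_holds

end Summit.HodgeConjecture.CorCM.HypDel

end
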